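import Summits.BirchSwinnertonDyer.BirchSwinnertonDyer.Theorems.SignedLowerHalvesSmallImageLowerHalfBothSignsRttColemanKummer
import Summits.BirchSwinnertonDyer.BirchSwinnertonDyer.Theorems.SignedLowerHalvesSmallImageLowerHalfBothSignsRttD2SeqJ3TorsionLevels
import HarnessLib

/-!
# Route `SignedLowerHalves`, crux L `SmallImageLowerHalfBothSigns` (stmt-BirchSwinnertonDyer-23599), line `rtt_w3` v38 — row S4‴ (`stub_junctionRecipValues_ns`), the Coleman side of
# `hval`, part F3 (glue): THE LEVEL-`(n,k)` TORSION-VALUED REPRESENTATIVE OF THE SCALED, TRANSLATED DIVISION CLASS `r·conj_σ e_{n,k}` — the class F1's pairing law evaluates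

WIDTH seat `bsd-line-slh-p3-w3` g29 under LEAD `cruxlead-stmt-BirchSwinnertonDyer-23599` g15 (cell `bsd-ssimc`; RULING «K-a / F1→honda» 2026-08-31T14:42:59Z; SPEC
`Lines/rtt_w3-SPEC-F1-w3-g29.md`). Helper `--supports stmt-BirchSwinnertonDyer-23599`. THEOREMS ONLY; no definition, no named fact, no instance, no `sorry`. HONEST FRAMING: bookkeeping
between the two currencies of the S4‴ proof. S4‴'s premises give the division classes `e_{n,k} ∈ E^ε_{sat,v}` on `U_∞` (represented by a cocycle `ψ` reading a `pᵏ`-division point `P` of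
`d_n` through `j`) and the readouts `DQ.toDual x₀ (scalarLocalSat r (conjLocalSat σ^i e_{n,k}))`; β1 (`exists_toDual_spec_zetaSp_eq_pairLoc`) computes `DQ.toDual x₀` on classes of the
form `res_{n→∞}(ℓ ↦ H¹(U_n, M))`, `ℓ ∈ H¹(U_{n,v}, M[pᵏ])`, as the level-`(n,k)` local Tate pairing `pairLoc … ℓ`; and the print input F1 (Kato Prop. 15.9 read on the local pairing,
typed by honda g30) speaks about `pairLoc`/`localPairingSubgroup` against the `M[pᵏ]`-valued Kummer class of a division point. This file supplies, for every `σ ∈ Γ_{K_v}` and `r ∈ R`,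
THE `ℓ`: an `M[pᵏ]`-valued continuous cocycle `φ` on `U_{n,v}` READING `σ·P` SCALED BY `r` (`(φ τ : M) = r·j(t)` whenever `ι(t) = τσP − σP`) with
`res_{n→∞}(torsToH1 [φ]) = ↑(scalarLocalSat r (conjLocalSat σ c))` — so F1 ∘ β1 lands exactly on the hypothesis `hread` of `sum_ev_mul_pow_sub_eq_of_pairingLaw` (p825989).
Nothing arithmetic is proved; S4‴, crux L and BSD remain OPEN and are proved for NO curve.

* ★★ `exists_torsion_cocycle_reads_smul_conj`.
References: [SerreGaloisCohomology1997] I §2.2, I §5.1; [Kobayashi2003] Def. 1.1, (8.23); [Rubin2000] §4.2, App. B.2.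
-/

set_option autoImplicit false
set_option linter.dupNamespace false -- D-0017: single-problem summit, the namespace repeats the problem name by design
noncomputable section

open scoped Classical
namespace Summit.BirchSwinnertonDyer.BirchSwinnertonDyer.Theorems.SmallImageRttReciprocity

open Literature.NumberTheory.EllipticCurves Literature.NumberTheory.EllipticCurves.Kobayashi2003 Literature.NumberTheory.GaloisRepresentations Field
  NumberField IsDedekindDomain SmallImageRttD2Seq SmallImageCharSignedSelmer

section LevelRep

variable {K : Type} [Field K] [NumberField K] {p : ℕ} [hp : Fact p.Prime] (κ : ZpExtension K p)
  {M : Type} [AddCommGroup M] [TopologicalSpace M] [DiscreteTopology M]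
  (R : Type*) [Ring R] [Module R M]
  (V : WeierstrassCurve K) [V.IsElliptic] (j : V.geomPrimaryTorsion p →+ M) (ε : ℤˣ)
  (v : HeightOneSpectrum (𝓞 K)) [DistribMulAction (absoluteGaloisGroup (v.adicCompletion K)) M]
  [SMulCommClass (absoluteGaloisGroup (v.adicCompletion K)) R M]

/-- ★★ **The level-`(n,k)` torsion-valued representative of `r·conj_σ c`.** Let `c ∈ E^ε_{sat,v}` be represented by a cocycle `ψ` on `U_∞` reading `P` through `j`, with `pᵏP` fixed
by `U_n = Gal(K̄_v/K_n·K_v)` (e.g. `pᵏP = d_n ∈ E(K_n·K_v)`). For every `σ ∈ Γ_{K_v}` and `r ∈ R` there is an `M[pᵏ]`-valued continuous cocycle `φ` on `U_n` reading `σP`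
scaled by `r` — `(φ τ : M) = r·j(t)` whenever `ι(t) = τ(σP) − σP` — whose class maps to `↑(scalarLocalSat r (conjLocalSat σ c))` under `res_{n→∞} ∘ (M[pᵏ] ⊆ M)_*`. (The values
`j(t_τ)` are `pᵏ`-torsion since `pᵏt_τ = 0`; `conj_σ ψ` reads `σP` and two cocycles on `U_∞` reading `σP` through `r·j` coincide.) [cite: SerreGaloisCohomology1997, I §5.1]
[cite: Kobayashi2003, Def. 1.1, (8.23)] [cite: Rubin2000, §4.2] -/
theorem exists_torsion_cocycle_reads_smul_conj
    (hj : ∀ (δ : absoluteGaloisGroup (v.adicCompletion K)) (t : V.geomPrimaryTorsion p),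
      j (resGalOfEmb (closureEmb (K := K) (v.adicCompletion K)) δ • t) = δ • j t)
    {n k : ℕ} (c : localCondInftySat κ M R V j ε v) (P : localPoints V (v.adicCompletion K))
    (hfix : ∀ τ : localSubgroupOfEmb (κ.layerSubgroup n) (closureEmb (K := K) (v.adicCompletion K)), (τ : absoluteGaloisGroup (v.adicCompletion K)) • (p ^ k • P) = p ^ k • P)
    (ψ : contOneCocycles (discreteTopRep (localSubgroupOfEmb κ.kerSubgroup (closureEmb (K := K) (v.adicCompletion K))) M))
    (hψ : ∀ (τ : localSubgroupOfEmb κ.kerSubgroup (closureEmb (K := K) (v.adicCompletion K))) (t : V.geomPrimaryTorsion p),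
      pointsMapOfEmb V (closureEmb (K := K) (v.adicCompletion K)) (t : V.geomPoints) = (τ : absoluteGaloisGroup (v.adicCompletion K)) • P - P → ψ.1 τ = j t)
    (hc : (c : subgroupH1 (localSubgroupOfEmb κ.kerSubgroup (closureEmb (K := K) (v.adicCompletion K))) M) = oneCocycleClass _ ψ)
    (σ : absoluteGaloisGroup (v.adicCompletion K)) (r : R) :
    ∃ φ : contOneCocycles (discreteTopRep (localSubgroupOfEmb (κ.layerSubgroup n) (closureEmb (K := K) (v.adicCompletion K))) ↥(torsionPow M p k)),
      (∀ (τ : localSubgroupOfEmb (κ.layerSubgroup n) (closureEmb (K := K) (v.adicCompletion K))) (t : V.geomPrimaryTorsion p),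
        pointsMapOfEmb V (closureEmb (K := K) (v.adicCompletion K)) (t : V.geomPoints) =
            (τ : absoluteGaloisGroup (v.adicCompletion K)) • (σ • P) - σ • P → ((φ.1 τ : ↥(torsionPow M p k)) : M) = r • j t) ∧
      resOfLe M (localSubgroupOfEmb_kerSubgroup_le κ v n)
          (torsToH1 M p (localSubgroupOfEmb (κ.layerSubgroup n) (closureEmb (K := K) (v.adicCompletion K))) k (oneCocycleClass _ φ)) =
        ((scalarLocalSat κ M R V j ε v r (conjLocalSat κ M R V j ε v σ c) : localCondInftySat κ M R V j ε v) :
          subgroupH1 (localSubgroupOfEmb κ.kerSubgroup (closureEmb (K := K) (v.adicCompletion K))) M) := by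
  haveI : CharZero (v.adicCompletion K) := Literature.NumberTheory.GaloisRepresentations.LocalField.charZero_adicCompletion v
  haveI := normal_localSubgroupOfEmb_kerSubgroup κ v
  haveI := ZpExtension.layerSubgroup_normal κ n
  haveI : (localSubgroupOfEmb (κ.layerSubgroup n) (closureEmb (K := K) (v.adicCompletion K))).Normal := Subgroup.normal_comap _
  -- `p^k (σP)` is fixed by `U_n` and by `U_∞`
  have hfixσ := smul_fixed_of_normal (p := p) V (localSubgroupOfEmb (κ.layerSubgroup n) (closureEmb (K := K) (v.adicCompletion K))) hfix σ
  have hfixσ' : ∀ τ : localSubgroupOfEmb κ.kerSubgroup (closureEmb (K := K) (v.adicCompletion K)),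
      (τ : absoluteGaloisGroup (v.adicCompletion K)) • (p ^ k • σ • P) = p ^ k • σ • P := fun τ ↦ hfixσ ⟨τ, localSubgroupOfEmb_kerSubgroup_le κ v n τ.2⟩
  -- the scaled reading map `r·j`
  let jr : V.geomPrimaryTorsion p →+ M := (DistribSMul.toAddMonoidHom M r).comp j
  have hjr : ∀ (δ : absoluteGaloisGroup (v.adicCompletion K)) (t : V.geomPrimaryTorsion p),
      jr (resGalOfEmb (closureEmb (K := K) (v.adicCompletion K)) δ • t) = δ • jr t := fun δ t ↦ by
    change r • j (resGalOfEmb (closureEmb (K := K) (v.adicCompletion K)) δ • t) = δ • (r • j t)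
    rw [hj]
    exact (smul_comm δ r (j t)).symm
  -- the `M`-valued cocycle on `U_n` reading `σP` through `r·j`
  obtain ⟨φM, hφM⟩ := exists_cocycle_reads V jr (localSubgroupOfEmb (κ.layerSubgroup n) (closureEmb (K := K) (v.adicCompletion K))) hjr (σ • P) hfixσ
  -- its values are `p^k`-torsion
  have hmem : ∀ τ : localSubgroupOfEmb (κ.layerSubgroup n) (closureEmb (K := K) (v.adicCompletion K)), φM.1 τ ∈ torsionPow M p k := fun τ ↦ by
    obtain ⟨t, ht⟩ := exists_pointsMapOfEmb_closureEmb_eq_of_nsmul_eq_zero (p := p) V _ (pow_smul_smul_sub_eq_zero V (hfixσ τ))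
    have hpt : p ^ k • t = 0 := torsionLift_unique (E := v.adicCompletion K) V (by
      rw [AddSubgroupClass.coe_nsmul, map_nsmul, ht, ZeroMemClass.coe_zero, map_zero, pow_smul_smul_sub_eq_zero V (hfixσ τ)])
    rw [mem_torsionPow_iff, hφM τ t ht, ← map_nsmul, hpt, map_zero]
  let φ : contOneCocycles (discreteTopRep (localSubgroupOfEmb (κ.layerSubgroup n) (closureEmb (K := K) (v.adicCompletion K))) ↥(torsionPow M p k)) :=
    ⟨⟨fun τ ↦ ⟨φM.1 τ, hmem τ⟩, φM.1.continuous.subtype_mk _⟩, fun τ τ' ↦ Subtype.ext (φM.2 τ τ')⟩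
  refine ⟨φ, fun τ t ht ↦ hφM τ t ht, ?_⟩
  -- the right-hand side is represented by `r·conj_σ ψ`, which reads `σP` through `r·j`
  obtain ⟨ψr, hψr, hcoe⟩ := coe_scalarLocalSat_of_eq_oneCocycleClass κ R V j ε v r (conjLocalSat κ M R V j ε v σ c)
    (coe_conjLocalSat_of_eq_oneCocycleClass κ R V j ε v σ c hc)
  have hψr' : ∀ (τ : localSubgroupOfEmb κ.kerSubgroup (closureEmb (K := K) (v.adicCompletion K))) (t : V.geomPrimaryTorsion p),
      pointsMapOfEmb V (closureEmb (K := K) (v.adicCompletion K)) (t : V.geomPoints) = (τ : absoluteGaloisGroup (v.adicCompletion K)) • (σ • P) - σ • P → ψr.1 τ = jr t :=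
    fun τ t ht ↦ by rw [hψr τ, reads_conjCocycle V j _ hj hψ σ τ t ht]; rfl
  -- the left-hand side is represented by the restriction of `φM` to `U_∞`
  rw [torsToH1_oneCocycleClass,
    show resOfLe M (localSubgroupOfEmb_kerSubgroup_le κ v n) (oneCocycleClass _ (contOneCocycles.pullback (ContinuousMonoidHom.id _)
        (resHomOfEquivariant (ContinuousMonoidHom.id _) (torsionPow M p k).subtype fun _ _ ↦ rfl) φ)) =
      oneCocycleClass _ (contOneCocycles.pullback (subgroupInclusion (localSubgroupOfEmb_kerSubgroup_le κ v n))
        (resHomOfEquivariant (subgroupInclusion (localSubgroupOfEmb_kerSubgroup_le κ v n)) (AddMonoidHom.id M) fun _ _ ↦ rfl)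
        (contOneCocycles.pullback (ContinuousMonoidHom.id _) (resHomOfEquivariant (ContinuousMonoidHom.id _) (torsionPow M p k).subtype fun _ _ ↦ rfl) φ)) from
      map_oneCocycleClass _ _ _ _, hcoe]
  congr 1
  refine cocycle_eq_of_reads V jr _ hfixσ' (fun τ t ht ↦ ?_) hψr'
  exact hφM ⟨τ, localSubgroupOfEmb_kerSubgroup_le κ v n τ.2⟩ t ht

end LevelRep

end Summit.BirchSwinnertonDyer.BirchSwinnertonDyer.Theorems.SmallImageRttReciprocity

end
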